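import Literature.MathematicalPhysics.QuantumFieldTheory.BalabanImbrieJaffe1984to88.BIJ88PassageMechanism593
import Literature.MathematicalPhysics.QuantumFieldTheory.BalabanImbrieJaffe1984to88.BIJ88Passage593Regime

/-!
# `BalabanImbrieJaffe1984to88.BIJ88RotationResidual282` — T. Bałaban, J. Imbrie, A. Jaffe, *Effective action and cluster
properties of the abelian Higgs model*, Commun. Math. Phys. **114** (1988) 257–315 [BalabanImbrieJaffe1988]:
p. 282 [PDF 26] (between (5.4.6) and (5.4.7)) and p. 296 [PDF 40] (proof of **(5.9.3)**), verbatim p. 282: *"There are still the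
phase factors at φ and ψ. We define φ′(x) = φ(x)e^{ie_k(Λ̄₃^{(k)}C_{k,loc}A′)(x)}, ψ′(y) = ψ(y)e^{ie_k(Λ̄₃^{(k)}C_{k,loc}A′)(y)}. By (2.26),
C_{k,loc}(x,b′) approximates the phase factors in (5.4.5), while being independent of □₀. … We have not yet integrated over ψ, so
a different density is obtained by replacing ψ′ with ψ. … After these rotations, the scalar field still have small, term-dependent
phase factors. The scalar fields appear as φ(x)exp[ie_k(w₂A′)(x)], ψ(y)exp[ie_k(w₂A′)(y)], where w₂ = Λ̄₃^{(k)}C_{k,loc} − Λ̄₃^{(k)}C_k□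
satisfies a bound |w₂(x,b)| ≦ exp(−cr(e_k))exp(−c dist(x,b)), (5.4.7)"*; p. 296: *"Also, the gauge transformation was not quite
compensated by a rotation of ψ."* — **THE ROTATION RESIDUAL of the passage `u_k → u_{k+1}` IDENTIFIED WITH THE PRINTED PHASE
`e_k(w₂A′)` AND SIZED FROM (5.4.7)**, and p02 g7's passage mechanism for (5.9.3) (`BIJ88PassageMechanism593`, where the residual
`μ` was the one remaining free datum, *"declared NOT identified"*) INSTANTIATED with it, so that every input of the printed proof of
(5.9.3) is now a printed datum carried on its own row of the skeleton. Theorems only (no `def`, no `Prop`-valued fact).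

statement-level skeleton of published theorems with citation tags; proofs where landed; nothing here is a claim about the Yang–Mills mass gap

PDF held: `paper:balaban1988-cmp114-bij-abelian-higgs-effective-action` (journal page = PDF page + 256); p. 282 [PDF 26] and p. 296
[PDF 40] re-read this session on the page IMAGES (r16's renders `HOME/lit-balaban-r16/renders/cmp114/original-p026-x2.png`,
`original-p040-x2.png`; the OCR layer garbles the displays), (5.4.5) p. 282: *"u_{k,b} → u′_{k,b} = u_{k,b}exp(−ie_kη(∂Λ̄₃^{(k)}C_k□A′)(b)),
φ(x) → φ(x)exp(ie_k(Λ̄₃^{(k)}C_k□A′)(x)), ψ(y) → ψ(y)exp(ie_k(Λ̄₃^{(k)}C_k□A′)(y))"*.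

CITATION HEADER (lean-in-tree rule).  Part of the lit-balaban TYPED SKELETON (HOME `run/shared/lean/pub/lit-balaban/`), Phase 2, seat
r16 gen 8 (unit `lit-balaban-r16`, reader/fold owner of C2 §5; TAKING line HOME/STATUS.md 2026-08-21T20:26:04Z); row **C2.Eq5.9.3** of
`HOME/lit-balaban-r16/ROWS-C2-part2.md` (v2.43: *"every step of the printed proof of (5.9.3) is a theorem … with inputs = printed data
on their own rows EXCEPT ONE: the rotation residual μ"*).  Inputs BY NAME: r18's (4.16) rotation `BIJ88Sect4Statements.bgGaugePhi`
and `bgGaugePhi_bgGaugePhi` (r16 g2), the typed (5.4.7) shape `BIJ88Sect5StatementsPart2.Ineq547` (r16 g0; model instance for `w₂`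
proved by p36 `BIJ88Ineq547Proof.ineq547_matrix`), r16's typed background forms (5.3.4) `bgExp`/(5.6.1) `uTilde561`/`bracket561`
(`BIJ88Sect5StatementsPart3/4`), p02's `passage593_mechanism_typed`/`passage593_datum'`/`abs_removedPhase_le` (g7) and
`ineq593_next` (g7, both regimes of p. 296–297 + «The desired bound follows»), r16's leaves `Ineq593` (5.9.3) and `Restr592` (5.9.2).

READING (declared).  (i) The gauge function of (5.4.5) on sites is `λ_□ := Λ̄₃^{(k)}C_k□A′`, the rotation actually substituted is by
`λ_loc := Λ̄₃^{(k)}C_{k,loc}A′`, and `w₂A′ = λ_loc − λ_□` (definition of `w₂`, r16's `BIJ88Sect5StatementsPart3.w2`); hence the exactly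
compensating rotation `ψe^{ie_kλ_□}` equals `ψ′·e^{−ie_k(w₂A′)}` and the substituted variable `ψ′` equals `(ψe^{ie_kλ_□})·e^{+ie_k(w₂A′)}`
— *"the scalar fields appear as ψ(y)exp[ie_k(w₂A′)(y)]"* (§1; the sign of the residual is immaterial below, only `|μ(b₊) − μ(b₋)|`
enters).  (ii) The residual phase of the block field in the passage of p. 296 is therefore `μ = e_k·(w₂A′)∘base` (`base` = the
embedding of the unit lattice `T₁^{(k)}` into `T_η`, as on p36's S3 carrier), `(w₂A′)(x) = Σ_b w₂(x,b)A′(b)`; its size follows from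
(5.4.7) (row C2.Eq5.4.7), `|A′_b| ≦ cp(e_k)` ((5.3.1) p. 280, row C2.Eq5.3.1-5.3.7) and a lattice-sum constant `Σ_b e^{−c dist(x,b)} ≦ S`
(geometry, in the normalization of (5.4.7); a hypothesis with `S` free, like p02's line-length data `n_ℓ`, `ℓ₀`) (§2–§3).  (iii) As in
p02 g7 §6 the gauge function itself is absorbed (p. 286 *"Q^{s*}_ke^{ie_kηλ} is a … gauge transformation … so we can delete it from
u_k"*): old fine field (5.3.4) `u_k = (Q^{s*}_{k+1}v)e^{ie_kηX_k}`, new fine field (5.6.1) `ũ_{k+1}`, new block field `e^{iμ}ψ`.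

WHAT IS PROVED (0 `sorry`, standard axioms).
* §1 `rotation545_eq_loc_mul_residual`, `subst282_eq_rotation545_mul_residual` (the p. 282 algebra on `bgGaugePhi`, any gauge
  functions with `r = λ_loc − λ_□`), `residual_eq_sum` (with kernels: `r = (K_loc − K_□)A′ = w₂A′`).
* §2 `abs_sum_mul_le_of_rowSum`, `rowSum_le_of_ineq547`, `abs_sum_mul_le_of_ineq547`: `|(w₂A′)(x)| ≦ e^{−cr(e_k)}·S·a` from the typed
  (5.4.7) shape, `|A′| ≦ a`, `Σ_b e^{−c dist(x,b)} ≦ S`.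
* §3 `abs_residual_le`, `abs_residual_sub_le` (`|μ(z₁) − μ(z₂)| ≦ e_k·(2e^{−cr(e_k)}Sc_A)·p(e_k)` — p02's datum shape `e_kM·p(e_k)` with
  `M` DERIVED), `passage593_mechanism_residual` (p02's `passage593_mechanism_typed` with `μ :=` the residual) and
  **`passage593_mechanism_residual_datum`**: `|D_{\overline{ũ_{k+1}}}(e^{iμ}ψ)(b)| ≦ |D_{ū_k}ψ(b)| + (ℓ₀(K₁ + L^{−2}K₂ + K₃) +
  2e^{−cr(e_k)}Sc_A)·e_k·p(e_k)²·|ψ(b₊)|` from per-bond field bounds on the line ((5.9.4), (5.9.1), (5.3.1) via `abs_removedPhase_le`),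
  (5.4.7), `|A′| ≦ c_Ap(e_k)`, and the geometry constants — NO free datum left.
* §4 the knit for the ROTATED block field: `norm_covD_rotated_eq` (`|D_{ū′}(e^{iμ}ψ)(b)| = |D_{ū″}ψ(b)|` with the effective coarse field
  `ū″(b) = ū(b)·e^{iθ}(line b)·e^{i(μ(b₊)−μ(b₋))}`), `norm_ubarEff_sub_le` (`|ū″(b) − ū(b)| ≦ |Σ_{line b}±θ| + |μ(b₊) − μ(b₋)|`),
  **`ineq593_next_rotated`** (p02's `ineq593_next` transported to the rotated block field: (5.9.2) + first step + summed defect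
  `≦ c₁e_kp(e_k)²` ⇒ `Ineq593 … (D_{ū′}(e^{iμ}ψ)) (c′+1) p(e_k)` on bonds into Λ₀′, d = 2,3, `e ≦ e₀`), and the END-TO-END statement on
  the typed forms **`ineq593_residual282`**: (5.9.3) for `D_{\overline{ũ_{k+1}}}(e^{ie_k(w₂A′)∘base}ψ)` from (5.9.2), the first step for
  `D_{ū_k}ψ`, the per-bond field bounds, (5.4.7), `|A′| ≦ c_Ap(e_k)` and the geometry constants, for every bare charge `e ≦ e₀(…)`.
NOT DONE HERE (honest scope).  The torus instances of `Q^{s*}_{k+1}v`, `H_{k,loc}A^{(k)}`, `𝒟^η_{k+1,loc}∂*Q^{e*}_{k+1}f`, `X_k`, `C_k`,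
`C_{k,loc}` with their bounds (rows C2.Eq5.3.x–5.6.x, C2.Eq5.4.7, C2 §2) — they enter as data in the printed shapes; the
lattice-sum constant `S` and the line data `n_ℓ`, `ℓ₀` are geometry hypotheses; `w₂` is any kernel obeying (5.4.7).  Imports p02's
`BIJ88PassageMechanism593` and `BIJ88Passage593Regime` (Literature + Mathlib only); declares no definition and no fact.
-/

namespace Literature.MathematicalPhysics.QuantumFieldTheory.BalabanImbrieJaffe1984to88.BIJ88RotationResidual282

open Literature.MathematicalPhysics.QuantumFieldTheory.Balaban1983to89
open BIJ88Sect3Statements BIJ88Sect4Statements BIJ88Sect5StatementsPart2 BIJ88Sect5StatementsPart3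
open BIJ88Sect5StatementsPart4 BIJ88Ineq593Proof BIJ88Restr592Proof BIJ88PassageMechanism593 BIJ88Passage593Regime
open BIJ88ChargePowerLogScale
open BIJ88Sect2Statements (pLog)
open Complex
open scoped BigOperators

variable {P : Params} {j j' : ℕ}

/-! ## §1 p. 282: the (5.4.5) rotation of the block field versus the substituted `C_{k,loc}`-rotation -/

section Algebra

/-- **p. 282** [PDF 26]: with `λ_□` the gauge function of (5.4.5) on sites (`Λ̄₃^{(k)}C_k□A′`), `λ_loc` the substituted rotation
(`Λ̄₃^{(k)}C_{k,loc}A′`, *"ψ′(y) = ψ(y)e^{ie_k(Λ̄₃^{(k)}C_{k,loc}A′)(y)}"*) and the residual `r = λ_loc − λ_□` (`= w₂A′`), the exactly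
compensating rotation of (5.4.5) is the substituted one times the residual phase: `ψe^{ie_kλ_□} = (ψe^{ie_kλ_loc})·e^{−ie_kr}` — *"C_{k,loc}
approximates the phase factors in (5.4.5)"*. [cite: BalabanImbrieJaffe1988, (5.4.7) p.282] -/
theorem rotation545_eq_loc_mul_residual (ek : ℝ) (lamLoc lamBox r : Balaban1983to89.Site P j → ℝ)
    (hr : ∀ x, r x = lamLoc x - lamBox x) (ψ : Balaban1983to89.Site P j → ℂ) :
    bgGaugePhi ek lamBox ψ = bgGaugePhi ek (fun x => -r x) (bgGaugePhi ek lamLoc ψ) := by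
  funext x
  simp only [bgGaugePhi]
  rw [mul_assoc, ← Complex.exp_add]
  congr 2
  rw [hr x]
  push_cast
  ring

/-- **p. 282** [PDF 26], *"The scalar fields appear as … ψ(y)exp[ie_k(w₂A′)(y)]"*: the substituted variable `ψ′ = ψe^{ie_kλ_loc}` equals
the exactly compensating rotation `ψe^{ie_kλ_□}` times `e^{+ie_kr}`, `r = λ_loc − λ_□ = w₂A′`. [cite: BalabanImbrieJaffe1988, (5.4.7) p.282] -/
theorem subst282_eq_rotation545_mul_residual (ek : ℝ) (lamLoc lamBox r : Balaban1983to89.Site P j → ℝ)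
    (hr : ∀ x, r x = lamLoc x - lamBox x) (ψ : Balaban1983to89.Site P j → ℂ) :
    bgGaugePhi ek lamLoc ψ = bgGaugePhi ek r (bgGaugePhi ek lamBox ψ) := by
  funext x
  simp only [bgGaugePhi]
  rw [mul_assoc, ← Complex.exp_add]
  congr 2
  rw [hr x]
  push_cast
  ring

/-- the residual with KERNELS: for `λ_loc = K_locA′`, `λ_□ = K_□A′` (`(KA′)(x) = Σ_b K(x,b)A′(b)`; print: `K_loc = Λ̄₃^{(k)}C_{k,loc}`,
`K_□ = Λ̄₃^{(k)}C_k□`) the residual is `((K_loc − K_□)A′)(x) = (w₂A′)(x)` — *"w₂ = Λ̄₃^{(k)}C_{k,loc} − Λ̄₃^{(k)}C_k□"* (r16's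
`BIJ88Sect5StatementsPart3.w2` in any ring of kernels). [cite: BalabanImbrieJaffe1988, (5.4.7) p.282] -/
theorem residual_eq_sum {B : Type} [Fintype B] (Kloc Kbox : Balaban1983to89.Site P j → B → ℝ) (A' : B → ℝ)
    (x : Balaban1983to89.Site P j) :
    (∑ b, Kloc x b * A' b) - (∑ b, Kbox x b * A' b) = ∑ b, (Kloc x b - Kbox x b) * A' b := by
  rw [← Finset.sum_sub_distrib]
  refine Finset.sum_congr rfl fun b _ => ?_
  ring

/-- in the ring of kernels `Matrix ι ι ℝ` (p36's model of (5.4.7)): applying r16's `w2 Λ3 Cloc Ck box = Λ3·Cloc − Λ3·Ck·box` to a field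
is the difference of the two rotations' gauge functions. [cite: BalabanImbrieJaffe1988, (5.4.7) p.282] -/
theorem w2_mulVec {ι : Type} [Fintype ι] [DecidableEq ι] (Λ3 Cloc Ck box : Matrix ι ι ℝ) (A' : ι → ℝ) :
    (w2 Λ3 Cloc Ck box).mulVec A' = (Λ3 * Cloc).mulVec A' - (Λ3 * Ck * box).mulVec A' := by
  simp only [w2, Matrix.sub_mulVec]

end Algebra

/-! ## §2 The size of `(w₂A′)(x)` from the (5.4.7) shape -/

section Size

variable {X B : Type} [Fintype B]

/-- `|Σ_b w(x,b)A′(b)| ≦ W·a` from a row sum `Σ_b |w(x,b)| ≦ W` and `|A′| ≦ a`. [cite: BalabanImbrieJaffe1988, (5.4.7) p.282] -/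
theorem abs_sum_mul_le_of_rowSum (w : X → B → ℝ) (A' : B → ℝ) {W a : ℝ} {x : X}
    (hW : ∑ b, |w x b| ≤ W) (hA : ∀ b, |A' b| ≤ a) (ha : 0 ≤ a) : |∑ b, w x b * A' b| ≤ W * a := by
  calc |∑ b, w x b * A' b| ≤ ∑ b, |w x b * A' b| := Finset.abs_sum_le_sum_abs _ _
    _ = ∑ b, |w x b| * |A' b| := by simp_rw [abs_mul]
    _ ≤ ∑ b, |w x b| * a := Finset.sum_le_sum fun b _ => mul_le_mul_of_nonneg_left (hA b) (abs_nonneg _)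
    _ = (∑ b, |w x b|) * a := by rw [Finset.sum_mul]
    _ ≤ W * a := mul_le_mul_of_nonneg_right hW ha

/-- the row sums of a kernel obeying the typed **(5.4.7)** shape `Ineq547`: `Σ_b |w₂(x,b)| ≦ e^{−cr(e_k)}·Σ_b e^{−c dist(x,b)} ≦ e^{−cr(e_k)}·S`.
[cite: BalabanImbrieJaffe1988, (5.4.7) p.282] -/
theorem rowSum_le_of_ineq547 (w : X → B → ℝ) (dist : X → B → ℝ) {c rk S : ℝ} (h547 : Ineq547 X B w dist c rk) {x : X}
    (hS : ∑ b, Real.exp (-(c * dist x b)) ≤ S) : ∑ b, |w x b| ≤ Real.exp (-(c * rk)) * S := by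
  calc ∑ b, |w x b| ≤ ∑ b, Real.exp (-(c * rk)) * Real.exp (-(c * dist x b)) := Finset.sum_le_sum fun b _ => h547 x b
    _ = Real.exp (-(c * rk)) * ∑ b, Real.exp (-(c * dist x b)) := by rw [Finset.mul_sum]
    _ ≤ Real.exp (-(c * rk)) * S := mul_le_mul_of_nonneg_left hS (Real.exp_pos _).le

/-- **(5.4.7) ⇒ the residual is small**: `|(w₂A′)(x)| ≦ e^{−cr(e_k)}·S·a` for `|A′| ≦ a` (print: `a = cp(e_k)`, (5.3.1) p. 280) and the
lattice-sum constant `Σ_b e^{−c dist(x,b)} ≦ S`. [cite: BalabanImbrieJaffe1988, (5.4.7) p.282] -/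
theorem abs_sum_mul_le_of_ineq547 (w : X → B → ℝ) (dist : X → B → ℝ) (A' : B → ℝ) {c rk S a : ℝ}
    (h547 : Ineq547 X B w dist c rk) {x : X} (hS : ∑ b, Real.exp (-(c * dist x b)) ≤ S) (hA : ∀ b, |A' b| ≤ a)
    (ha : 0 ≤ a) : |∑ b, w x b * A' b| ≤ Real.exp (-(c * rk)) * S * a :=
  abs_sum_mul_le_of_rowSum w A' (rowSum_le_of_ineq547 w dist h547 hS) hA ha

end Size

/-! ## §3 The rotation residual `μ = e_k·(w₂A′)∘base` in p02's passage mechanism: the datum `|μ(b₊) − μ(b₋)| ≦ e_kM·p(e_k)` DERIVED -/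

section Residual

variable (w₂ : Balaban1983to89.Site P j → PBond P j → ℝ) (dist : Balaban1983to89.Site P j → PBond P j → ℝ)
  (A' : PBond P j → ℝ) (base : Balaban1983to89.Site P j' → Balaban1983to89.Site P j)

/-- `|μ(z)| = e_k|(w₂A′)(base z)| ≦ e_k·e^{−cr(e_k)}·S·a`. [cite: BalabanImbrieJaffe1988, (5.9.3) p.296] -/
theorem abs_residual_le {ek c rk S a : ℝ} (hek : 0 ≤ ek) (h547 : Ineq547 _ _ w₂ dist c rk)
    (hS : ∀ x, ∑ b, Real.exp (-(c * dist x b)) ≤ S) (hA : ∀ b, |A' b| ≤ a) (ha : 0 ≤ a) (z : Balaban1983to89.Site P j') :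
    |ek * ∑ b, w₂ (base z) b * A' b| ≤ ek * (Real.exp (-(c * rk)) * S * a) := by
  rw [abs_mul, abs_of_nonneg hek]
  exact mul_le_mul_of_nonneg_left (abs_sum_mul_le_of_ineq547 w₂ dist A' h547 (hS _) hA ha) hek

/-- **the datum of p02's `passage593_datum'` DERIVED**: with `|A′| ≦ c_A·p(e_k)` ((5.3.1)), (5.4.7) for `w₂` and the lattice-sum constant
`S`, the rotation residual obeys `|μ(z₁) − μ(z₂)| ≦ e_k·(2e^{−cr(e_k)}Sc_A)·p(e_k)` — the shape `e_kM·p(e_k)` with `M = 2e^{−cr(e_k)}Sc_A`.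
[cite: BalabanImbrieJaffe1988, (5.9.3) p.296] -/
theorem abs_residual_sub_le {ek c rk S cA pek : ℝ} (hek : 0 ≤ ek) (h547 : Ineq547 _ _ w₂ dist c rk)
    (hS : ∀ x, ∑ b, Real.exp (-(c * dist x b)) ≤ S) (hA : ∀ b, |A' b| ≤ cA * pek) (hcA : 0 ≤ cA) (hp : 0 ≤ pek)
    (z₁ z₂ : Balaban1983to89.Site P j') :
    |ek * ∑ b, w₂ (base z₁) b * A' b - ek * ∑ b, w₂ (base z₂) b * A' b|
      ≤ ek * (2 * Real.exp (-(c * rk)) * S * cA) * pek := by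
  have ha : 0 ≤ cA * pek := mul_nonneg hcA hp
  have h1 := abs_residual_le w₂ dist A' base hek h547 hS hA ha z₁
  have h2 := abs_residual_le w₂ dist A' base hek h547 hS hA ha z₂
  calc |ek * ∑ b, w₂ (base z₁) b * A' b - ek * ∑ b, w₂ (base z₂) b * A' b|
      ≤ |ek * ∑ b, w₂ (base z₁) b * A' b| + |ek * ∑ b, w₂ (base z₂) b * A' b| := abs_sub _ _
    _ ≤ ek * (Real.exp (-(c * rk)) * S * (cA * pek)) + ek * (Real.exp (-(c * rk)) * S * (cA * pek)) := add_le_add h1 h2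
    _ = ek * (2 * Real.exp (-(c * rk)) * S * cA) * pek := by ring

/-- **p02's passage mechanism WITH THE PRINTED RESIDUAL**: `passage593_mechanism_typed` (old fine field (5.3.4)
`u_k = (Q^{s*}_{k+1}v)e^{ie_kηX_k}`, new fine field (5.6.1) `ũ_{k+1}`, coarse fields along `line b`) for the block field rotated by
`μ = e_k·(w₂A′)∘base`: `|D_{\overline{ũ_{k+1}}}(e^{iμ}ψ)(b)| ≦ |D_{ū_k}ψ(b)| + (|Σ_{line b}±e_kη[bracket561 − X_k]| + |μ(b₊) − μ(b₋)|)·|ψ(b₊)|`.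
[cite: BalabanImbrieJaffe1988, (5.9.3) p.296] -/
theorem passage593_mechanism_residual {ek η L : ℝ} {Q : PBond P j → ℂ} (hQ : ∀ b, ‖Q b‖ = 1)
    (θk HA DXf Xk : PBond P j → ℝ) (ψ : Balaban1983to89.Site P j' → ℂ) (line : PBond P j' → Contour P j) (b : PBond P j')
    (hline : IsPath (base b.src) (line b) (base b.tgt)) :
    ‖covD 1 (fun b' => transport (uTilde561 ek η L Q θk HA DXf) (line b'))
        (fun z => exp ((((ek * ∑ e, w₂ (base z) e * A' e : ℝ)) : ℂ) * I) * ψ z) b‖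
      ≤ ‖covD 1 (fun b' => transport (bgExp ek η Q Xk) (line b')) ψ b‖
        + (|signedSum (fun e => ek * η * (bracket561 L θk HA DXf e - Xk e)) (line b)|
            + |ek * ∑ e, w₂ (base b.tgt) e * A' e - ek * ∑ e, w₂ (base b.src) e * A' e|) * ‖ψ b.tgt‖ :=
  passage593_mechanism_typed hQ θk HA DXf Xk (fun z => ek * ∑ e, w₂ (base z) e * A' e) ψ base line b hline

/-- **the passage of p. 296 with NO free datum**: per-bond field bounds on the line bonds — `0 ≦ θ_k ≦ 1`, `|H_{k,loc}A^{(k)}| ≦ K₁p(e_k)`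
((5.9.4) + (2.5)), `|𝒟^η_{k+1,loc}∂*Q^{e*}_{k+1}f| ≦ K₂p(e_k)` ((5.9.1) + (2.13)), `|X_k| ≦ K₃p(e_k)` ((5.3.1), (5.4.7)/(5.5.5)) —, the line
geometry (`≦ n_ℓ` bonds, `η·n_ℓ ≦ ℓ₀`), the (5.4.7) shape for `w₂` with `|A′| ≦ c_Ap(e_k)` ((5.3.1)) and `Σ_b e^{−c dist(x,b)} ≦ S` give
`|D_{\overline{ũ_{k+1}}}(e^{iμ}ψ)(b)| ≦ |D_{ū_k}ψ(b)| + (ℓ₀(K₁ + L^{−2}K₂ + K₃) + 2e^{−cr(e_k)}Sc_A)·e_k·p(e_k)²·|ψ(b₊)|` for the printed residual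
`μ = e_k·(w₂A′)∘base` — the input shape `c₁e_kp(e_k)²` of p02 g6's `passage593_order` with `c₁` made of printed constants.
[cite: BalabanImbrieJaffe1988, (5.9.3) p.296] -/
theorem passage593_mechanism_residual_datum {ek η L pek K₁ K₂ K₃ ℓ₀ c rk S cA : ℝ} {nℓ : ℕ} {Q : PBond P j → ℂ}
    (hQ : ∀ b, ‖Q b‖ = 1) (θk HA DXf Xk : PBond P j → ℝ) (ψ : Balaban1983to89.Site P j' → ℂ)
    (line : PBond P j' → Contour P j) (b : PBond P j') (hline : IsPath (base b.src) (line b) (base b.tgt))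
    (hek : 0 ≤ ek) (hη : 0 ≤ η) (hp : 1 ≤ pek) (hK₁ : 0 ≤ K₁) (hK₂ : 0 ≤ K₂) (hK₃ : 0 ≤ K₃)
    (hfields : ∀ sg ∈ line b, 0 ≤ θk sg.1 ∧ θk sg.1 ≤ 1 ∧ |HA sg.1| ≤ K₁ * pek ∧ |DXf sg.1| ≤ K₂ * pek ∧ |Xk sg.1| ≤ K₃ * pek)
    (hn : (line b).length ≤ nℓ) (hℓ : η * nℓ ≤ ℓ₀)
    (h547 : Ineq547 _ _ w₂ dist c rk) (hS : ∀ x, ∑ e, Real.exp (-(c * dist x e)) ≤ S) (hS0 : 0 ≤ S)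
    (hA : ∀ e, |A' e| ≤ cA * pek) (hcA : 0 ≤ cA) :
    ‖covD 1 (fun b' => transport (uTilde561 ek η L Q θk HA DXf) (line b'))
        (fun z => exp ((((ek * ∑ e, w₂ (base z) e * A' e : ℝ)) : ℂ) * I) * ψ z) b‖
      ≤ ‖covD 1 (fun b' => transport (bgExp ek η Q Xk) (line b')) ψ b‖
        + (ℓ₀ * (K₁ + L⁻¹ ^ 2 * K₂ + K₃) + 2 * Real.exp (-(c * rk)) * S * cA) * ek * pek ^ 2 * ‖ψ b.tgt‖ := by
  have hp0 : 0 ≤ pek := zero_le_one.trans hp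
  have hK : 0 ≤ K₁ + L⁻¹ ^ 2 * K₂ + K₃ := add_nonneg (add_nonneg hK₁ (mul_nonneg (sq_nonneg _) hK₂)) hK₃
  have hM : 0 ≤ 2 * Real.exp (-(c * rk)) * S * cA :=
    mul_nonneg (mul_nonneg (mul_nonneg zero_le_two (Real.exp_pos _).le) hS0) hcA
  have hθ : ∀ sg ∈ line b, |ek * η * (bracket561 L θk HA DXf sg.1 - Xk sg.1)| ≤ ek * η * (K₁ + L⁻¹ ^ 2 * K₂ + K₃) * pek := by
    intro sg hsg
    obtain ⟨h0, h1, hHA, hDXf, hXk⟩ := hfields sg hsg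
    exact abs_removedPhase_le hek hη h0 h1 hHA hDXf hXk
  have hμ := abs_residual_sub_le w₂ dist A' base hek h547 hS hA hcA hp0 b.tgt b.src
  have hdat := passage593_datum' (fun e => ek * η * (bracket561 L θk HA DXf e - Xk e)) (line b) hek hη hK hM hp hθ hn hℓ hμ
  exact (passage593_mechanism_residual w₂ A' base hQ θk HA DXf Xk ψ line b hline).trans
    (add_le_add le_rfl (mul_le_mul_of_nonneg_right hdat (norm_nonneg _)))

end Residual

/-! ## §4 «The desired bound follows» for the ROTATED block field: (5.9.3) end to end with the printed residual -/

section Knit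

/-- the rotated block field seen through an EFFECTIVE coarse field: for `ū′(b) = \overline{u·e^{iθ}}(line b)` and `ψ′ = e^{iμ}ψ`,
`|D_{ū′}ψ′(b)| = |D_{ū″}ψ(b)|` with `ū″(b) = ū(b)·e^{iθ}(line b)·e^{i(μ(b₊) − μ(b₋))}` (the block-field phase at `b₋` factors out).
[cite: BalabanImbrieJaffe1988, (5.9.3) p.296] -/
theorem norm_covD_rotated_eq (u : PBond P j → ℂ) (θ : PBond P j → ℝ) (μ : Balaban1983to89.Site P j' → ℝ)
    (ψ : Balaban1983to89.Site P j' → ℂ) (line : PBond P j' → Contour P j) (b : PBond P j') :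
    ‖covD 1 (fun b' => transport (fun e => u e * phaseCfg θ e) (line b')) (fun z => exp (((μ z : ℝ) : ℂ) * I) * ψ z) b‖
      = ‖covD 1 (fun b' => transport u (line b') * transport (phaseCfg θ) (line b')
          * exp (((μ b'.tgt - μ b'.src : ℝ) : ℂ) * I)) ψ b‖ := by
  simp only [covD, Complex.ofReal_one, one_mul, transport_mul]
  have key : exp (((μ b.tgt : ℝ) : ℂ) * I) = exp (((μ b.tgt - μ b.src : ℝ) : ℂ) * I) * exp (((μ b.src : ℝ) : ℂ) * I) := by
    rw [← Complex.exp_add]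
    congr 1
    push_cast
    ring
  have h : transport u (line b) * transport (phaseCfg θ) (line b) * (exp (((μ b.tgt : ℝ) : ℂ) * I) * ψ b.tgt)
        - exp (((μ b.src : ℝ) : ℂ) * I) * ψ b.src
      = exp (((μ b.src : ℝ) : ℂ) * I) *
        (transport u (line b) * transport (phaseCfg θ) (line b) * exp (((μ b.tgt - μ b.src : ℝ) : ℂ) * I) * ψ b.tgt
          - ψ b.src) := by
    rw [key]; ring
  rw [h, norm_mul, norm_exp_ofReal_mul_I, one_mul]

/-- the defect of the effective coarse field: for unit-modulus `u`, `|ū″(b) − ū(b)| ≦ |Σ_{line b}±θ| + |μ(b₊) − μ(b₋)|` («removed some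
small fields» + «not quite compensated»). [cite: BalabanImbrieJaffe1988, (5.9.3) p.296] -/
theorem norm_ubarEff_sub_le (u : PBond P j → ℂ) (hu : ∀ b, ‖u b‖ = 1) (θ : PBond P j → ℝ)
    (μ : Balaban1983to89.Site P j' → ℝ) (line : PBond P j' → Contour P j) (b : PBond P j') :
    ‖transport u (line b) * transport (phaseCfg θ) (line b) * exp (((μ b.tgt - μ b.src : ℝ) : ℂ) * I) - transport u (line b)‖
      ≤ |signedSum θ (line b)| + |μ b.tgt - μ b.src| := by
  have hT : ‖transport u (line b)‖ = 1 := norm_transport u hu (line b)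
  have h1 : transport u (line b) * transport (phaseCfg θ) (line b) * exp (((μ b.tgt - μ b.src : ℝ) : ℂ) * I)
        - transport u (line b)
      = transport u (line b) * (transport (phaseCfg θ) (line b) * exp (((μ b.tgt - μ b.src : ℝ) : ℂ) * I) - 1) := by ring
  rw [h1, norm_mul, hT, one_mul]
  refine (norm_mul_exp_sub_one_le _ _).trans (add_le_add ?_ le_rfl)
  rw [transport_phaseCfg, mul_comm]
  exact Real.norm_exp_I_mul_ofReal_sub_one_le.trans (le_of_eq (Real.norm_eq_abs _))

/-- **(5.9.3) for the ROTATED block field** — p02 g7's `ineq593_next` («The desired bound follows», both regimes of p. 296–297)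
transported along `norm_covD_rotated_eq`: for d = 2, 3, `c, c₁ ≥ 0`, `λ, p > 0`, `0 < α ≤ ¼`, `0 ≤ β < 1` there is `e₀ > 0` (depending on
these constants only) such that for every bare charge `0 < e ≤ e₀`, scale `0 < s = L^kε ≤ ε₀ ≤ e^β`, `e_k = s^{(4−d)/2}e`, `λ_k = s^{4−d}λ`,
`p(e_k) = pLog p e_k`: IF the block field obeys (5.9.2) on Λ₀′ (`Restr592`), the summed defect of the passage (removed phases along
`line b` + residual) is `≤ c₁e_kp(e_k)²` on bonds into Λ₀′, and the FIRST STEP `|D_ūψ(b)| ≤ c′p(e_k)` holds there, THEN the new pair —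
fine field `u·e^{iθ}`, block field `e^{iμ}ψ` — satisfies `|D_{ū′}(e^{iμ}ψ)(b)| ≤ (c′+1)p(e_k)` on bonds into Λ₀′.
[cite: BalabanImbrieJaffe1988, (5.9.3) p.297] -/
theorem ineq593_next_rotated {d : ℕ} (hd2 : 2 ≤ d) (hd : d ≤ 3) {c c₁ lam p α β : ℝ} (hc : 0 ≤ c) (hc₁ : 0 ≤ c₁)
    (hlam : 0 < lam) (hp : 0 < p) (hα : 0 < α) (hα4 : α ≤ 1 / 4) (hβ0 : 0 ≤ β) (hβ : β < 1) :
    ∃ e₀ > 0, ∀ e s ε₀ : ℝ, 0 < e → e ≤ e₀ → 0 < s → s ≤ ε₀ → ε₀ ≤ e ^ β →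
      ∀ {ek lamk pek : ℝ}, ek = s ^ ((4 - (d : ℝ)) / 2) * e → lamk = s ^ (4 - (d : ℝ)) * lam → pek = pLog p ek →
      ∀ {Λ0' : Finset (Balaban1983to89.Site P j')} {ψ : Balaban1983to89.Site P j' → ℂ} (u : PBond P j → ℂ)
        (_hu : ∀ b, ‖u b‖ = 1) (θ : PBond P j → ℝ) (μ : Balaban1983to89.Site P j' → ℝ) (line : PBond P j' → Contour P j)
        {c' : ℝ},
        Restr592 c pek lamk lam s d Λ0' ψ →
        (∀ b : PBond P j', b.tgt ∈ Λ0' → |signedSum θ (line b)| + |μ b.tgt - μ b.src| ≤ c₁ * ek * pek ^ 2) →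
        Ineq593 (PBond P j') (fun b => b.tgt ∈ Λ0') (covD 1 (fun b' => transport u (line b')) ψ) c' pek →
        Ineq593 (PBond P j') (fun b => b.tgt ∈ Λ0')
          (covD 1 (fun b' => transport (fun e => u e * phaseCfg θ e) (line b'))
            (fun z => exp (((μ z : ℝ) : ℂ) * I) * ψ z)) (c' + 1) pek := by
  obtain ⟨e₀, he₀, h⟩ := ineq593_next (P := P) (j := j') hd2 hd hc hc₁ hlam hp hα hα4 hβ0 hβ
  refine ⟨e₀, he₀, ?_⟩
  intro e s ε₀ he hele hs hsε₀ hε₀e ek lamk pek hek hlamk hpek Λ0' ψ u hu θ μ line c' h592 hdef hfirst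
  have H := h e s ε₀ he hele hs hsε₀ hε₀e hek hlamk hpek (fun b' => transport u (line b'))
    (fun b' => transport u (line b') * transport (phaseCfg θ) (line b') * exp (((μ b'.tgt - μ b'.src : ℝ) : ℂ) * I))
    h592 (fun b hb => (norm_ubarEff_sub_le u hu θ μ line b).trans (hdef b hb)) hfirst
  intro b hb
  rw [norm_covD_rotated_eq]
  exact H b hb

/-- **(5.9.3) END TO END WITH THE PRINTED RESIDUAL** (pp. 282, 296–297): for d = 2, 3, `λ, p > 0`, `0 < α ≤ ¼`, `0 ≤ β < 1`, `c ≥ 0`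
and non-negative constants `ℓ₀, K₁, K₂, K₃, S, c_A` (and any `L`) there is `e₀ > 0` depending on them only such that for every bare
charge `0 < e ≤ e₀` and scale `0 < s = L^kε ≤ ε₀ ≤ e^β` (`e_k`, `λ_k`, `p(e_k)` as printed), every `η ≥ 0`, `n_ℓ` with `ηn_ℓ ≤ ℓ₀`: IF the
old fine field is (5.3.4) `u_k = (Q^{s*}_{k+1}v)e^{ie_kηX_k}` (`|Q^{s*}_{k+1}v| = 1`), the new one is (5.6.1) `ũ_{k+1}`, the field bounds
`0 ≤ θ_k ≤ 1`, `|H_{k,loc}A^{(k)}| ≤ K₁p(e_k)`, `|𝒟…f| ≤ K₂p(e_k)`, `|X_k| ≤ K₃p(e_k)` hold on the `≤ n_ℓ` bonds of the lines into Λ₀′, `w₂`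
obeys (5.4.7) (decay rate `c_w`, `c_wr(e_k) ≥ 0`) with `Σ_b e^{−c_w dist(x,b)} ≤ S`, `|A′| ≤ c_Ap(e_k)` ((5.3.1)), the block field obeys
(5.9.2) on Λ₀′ and the first step `|D_{ū_k}ψ(b)| ≤ c′p(e_k)` holds on bonds into Λ₀′, THEN
`|D_{\overline{ũ_{k+1}}}(e^{ie_k(w₂A′)∘base}ψ)(b)| ≤ (c′+1)p(e_k)` on bonds into Λ₀′ — (5.9.3) for the new fields, the residual rotation
being the printed one. [cite: BalabanImbrieJaffe1988, (5.9.3) p.297] -/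
theorem ineq593_residual282 {d : ℕ} (hd2 : 2 ≤ d) (hd : d ≤ 3) {c lam p α β : ℝ} (hc : 0 ≤ c) (hlam : 0 < lam)
    (hp : 0 < p) (hα : 0 < α) (hα4 : α ≤ 1 / 4) (hβ0 : 0 ≤ β) (hβ : β < 1)
    {L ℓ₀ K₁ K₂ K₃ S cA : ℝ} (hℓ₀ : 0 ≤ ℓ₀) (hK₁ : 0 ≤ K₁) (hK₂ : 0 ≤ K₂) (hK₃ : 0 ≤ K₃) (hS0 : 0 ≤ S)
    (hcA : 0 ≤ cA) :
    ∃ e₀ > 0, ∀ e s ε₀ : ℝ, 0 < e → e ≤ e₀ → 0 < s → s ≤ ε₀ → ε₀ ≤ e ^ β →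
      ∀ {ek lamk pek : ℝ}, ek = s ^ ((4 - (d : ℝ)) / 2) * e → lamk = s ^ (4 - (d : ℝ)) * lam → pek = pLog p ek →
      ∀ {η : ℝ} {nℓ : ℕ}, 0 ≤ η → η * nℓ ≤ ℓ₀ →
      ∀ {Q : PBond P j → ℂ} (_hQ : ∀ b, ‖Q b‖ = 1) (θk HA DXf Xk : PBond P j → ℝ)
        (w₂ : Balaban1983to89.Site P j → PBond P j → ℝ) (dist : Balaban1983to89.Site P j → PBond P j → ℝ) {cw rk : ℝ}
        (A' : PBond P j → ℝ) (base : Balaban1983to89.Site P j' → Balaban1983to89.Site P j)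
        (line : PBond P j' → Contour P j) {Λ0' : Finset (Balaban1983to89.Site P j')}
        {ψ : Balaban1983to89.Site P j' → ℂ} {c' : ℝ},
        Ineq547 _ _ w₂ dist cw rk → 0 ≤ cw * rk → (∀ x, ∑ b, Real.exp (-(cw * dist x b)) ≤ S) →
        (∀ b, |A' b| ≤ cA * pek) →
        (∀ b : PBond P j', b.tgt ∈ Λ0' → IsPath (base b.src) (line b) (base b.tgt) ∧ (line b).length ≤ nℓ ∧
          ∀ sg ∈ line b, 0 ≤ θk sg.1 ∧ θk sg.1 ≤ 1 ∧ |HA sg.1| ≤ K₁ * pek ∧ |DXf sg.1| ≤ K₂ * pek ∧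
            |Xk sg.1| ≤ K₃ * pek) →
        Restr592 c pek lamk lam s d Λ0' ψ →
        Ineq593 (PBond P j') (fun b => b.tgt ∈ Λ0') (covD 1 (fun b' => transport (bgExp ek η Q Xk) (line b')) ψ) c' pek →
        Ineq593 (PBond P j') (fun b => b.tgt ∈ Λ0')
          (covD 1 (fun b' => transport (uTilde561 ek η L Q θk HA DXf) (line b'))
            (fun z => exp ((((ek * ∑ e, w₂ (base z) e * A' e : ℝ)) : ℂ) * I) * ψ z)) (c' + 1) pek := by
  -- the constant of the summed defect, made of printed constants (e^{-c_w r(e_k)} ≤ 1 is used for the residual part)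
  set K : ℝ := K₁ + L⁻¹ ^ 2 * K₂ + K₃ with hK_def
  have hK : 0 ≤ K := add_nonneg (add_nonneg hK₁ (mul_nonneg (sq_nonneg _) hK₂)) hK₃
  set c₁ : ℝ := ℓ₀ * K + 2 * S * cA with hc₁_def
  have hc₁ : 0 ≤ c₁ := add_nonneg (mul_nonneg hℓ₀ hK) (mul_nonneg (mul_nonneg zero_le_two hS0) hcA)
  obtain ⟨e₀, he₀, h⟩ := ineq593_next_rotated (P := P) (j := j) (j' := j') hd2 hd hc hc₁ hlam hp hα hα4 hβ0 hβ
  refine ⟨min (Real.exp (-1)) e₀, lt_min (Real.exp_pos _) he₀, ?_⟩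
  intro e s ε₀ he hele hs hsε₀ hε₀e ek lamk pek hek hlamk hpek η nℓ hη hℓ Q hQ θk HA DXf Xk w₂ dist cw rk A' base line Λ0' ψ c'
    h547 hcr hS hA hgeom h592 hfirst
  -- e_k ≥ 0 and p(e_k) ≥ 1 (as in p02's `ineq593_next`)
  have hd3 : (d : ℝ) ≤ 3 := by exact_mod_cast hd
  have hm0 : 0 ≤ (4 - (d : ℝ)) / 2 := by linarith
  have heexp : e ≤ Real.exp (-1) := hele.trans (min_le_left _ _)
  have he1 : e ≤ 1 := heexp.trans (Real.exp_le_one_iff.2 (by norm_num))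
  have hs1 : s ≤ 1 := hsε₀.trans (hε₀e.trans (Real.rpow_le_one he.le he1 hβ0))
  have hek0 : 0 < ek := by rw [hek]; exact mul_pos (Real.rpow_pos_of_pos hs _) he
  have hek1 : ek ≤ Real.exp (-1) := by
    rw [hek]
    calc s ^ ((4 - (d : ℝ)) / 2) * e ≤ 1 * e := mul_le_mul_of_nonneg_right (Real.rpow_le_one hs.le hs1 hm0) he.le
      _ = e := one_mul _
      _ ≤ Real.exp (-1) := heexp
  have hp1 : 1 ≤ pek := by rw [hpek]; exact one_le_pLog hp.le hek0 hek1
  have hp0 : 0 ≤ pek := zero_le_one.trans hp1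
  -- the typed new fine field IS `u_k · e^{iθ}` with the removed phases θ
  set θ : PBond P j → ℝ := fun e' => ek * η * (bracket561 L θk HA DXf e' - Xk e') with hθ_def
  have hfun : uTilde561 ek η L Q θk HA DXf = fun e' => bgExp ek η Q Xk e' * phaseCfg θ e' :=
    funext fun e' => uTilde561_eq_mul_phaseCfg ek η L Q θk HA DXf Xk e'
  rw [hfun]
  -- the summed defect on bonds into Λ₀′ is ≤ c₁ e_k p(e_k)²
  have hdef : ∀ b : PBond P j', b.tgt ∈ Λ0' →
      |signedSum θ (line b)| + |ek * ∑ e', w₂ (base b.tgt) e' * A' e' - ek * ∑ e', w₂ (base b.src) e' * A' e'|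
        ≤ c₁ * ek * pek ^ 2 := by
    intro b hb
    obtain ⟨_, hn, hfields⟩ := hgeom b hb
    have hθb : ∀ sg ∈ line b, |θ sg.1| ≤ ek * η * K * pek := by
      intro sg hsg
      obtain ⟨h0, h1, hHA, hDXf, hXk⟩ := hfields sg hsg
      exact abs_removedPhase_le hek0.le hη h0 h1 hHA hDXf hXk
    have hM : 0 ≤ 2 * Real.exp (-(cw * rk)) * S * cA :=
      mul_nonneg (mul_nonneg (mul_nonneg zero_le_two (Real.exp_pos _).le) hS0) hcA
    have hμ := abs_residual_sub_le w₂ dist A' base hek0.le h547 hS hA hcA hp0 b.tgt b.src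
    have hdat := passage593_datum' θ (line b) hek0.le hη hK hM hp1 hθb hn hℓ hμ
    -- e^{-c_w r(e_k)} ≤ 1
    have hexp : Real.exp (-(cw * rk)) ≤ 1 := Real.exp_le_one_iff.2 (by linarith)
    have hM' : 2 * Real.exp (-(cw * rk)) * S * cA ≤ 2 * S * cA := by
      have : 0 ≤ 2 * S * cA := mul_nonneg (mul_nonneg zero_le_two hS0) hcA
      nlinarith
    have hmono : (ℓ₀ * K + 2 * Real.exp (-(cw * rk)) * S * cA) * ek * pek ^ 2 ≤ c₁ * ek * pek ^ 2 := by
      have h2 : 0 ≤ ek * pek ^ 2 := mul_nonneg hek0.le (sq_nonneg _)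
      have : ℓ₀ * K + 2 * Real.exp (-(cw * rk)) * S * cA ≤ c₁ := by rw [hc₁_def]; linarith
      calc (ℓ₀ * K + 2 * Real.exp (-(cw * rk)) * S * cA) * ek * pek ^ 2
          = (ℓ₀ * K + 2 * Real.exp (-(cw * rk)) * S * cA) * (ek * pek ^ 2) := by ring
        _ ≤ c₁ * (ek * pek ^ 2) := mul_le_mul_of_nonneg_right this h2
        _ = c₁ * ek * pek ^ 2 := by ring
    exact hdat.trans hmono
  exact h e s ε₀ he (hele.trans (min_le_right _ _)) hs hsε₀ hε₀e hek hlamk hpek (bgExp ek η Q Xk) (norm_bgExp hQ Xk) θ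
    (fun z => ek * ∑ e', w₂ (base z) e' * A' e') line h592 hdef hfirst

end Knit

end Literature.MathematicalPhysics.QuantumFieldTheory.BalabanImbrieJaffe1984to88.BIJ88RotationResidual282
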